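import Summits.ResolutionOfSingularities.ResolutionOfSingularities.Theorems.FrobeniusClosingPatchingRelPerfectDepthMultiHostCylCentre
import Mathlib.RingTheory.RegularLocalRing.Polynomial
import HarnessLib

/-!
# Crux `PatchingRelPerfect` (stmt-ResolutionOfSingularities-16161), chain W5.2 — F7(β) d = 2 (β-AX), X2a module 2 (M2c), e-chart step E2a:
# the SECTION ISOMORPHISM `A/𝔞 ≅ B/((t) + 𝔞B)` at a carrier point of the cylinder region

[OURS · L1 W5.2 · F7(β) (β-AX) X-side · res-D-pv-034 AS res-L1-s36-pv-3 per res-L1-w52-plan-1 RULING G11-21 ((M2c) PARAM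
PROPAGATION, e-chart half; blueprint `D/res-D-pv-034/M2C-ECHART-BLUEPRINT.md` step E2).]  Replaces the role of NO printed item;
NOT a statement of the manuscript under review; fact-free, def-free.  AI-written; AI review is weaker than expert review.

At a carrier point `y = jV z₀` of the cylinder region the stalk map `σ = q^♯ : A = 𝒪_{Z,q y} → B = 𝒪_{V,y}` has a left inverse up to
isomorphism (`jV^♯`, kernel `(t)`, `t` the local equation of the carrier), so `B = σ(A) + tB` and `σ⁻¹((t) + 𝔞B) = 𝔞`: for EVERY ideal
`𝔞 ⊆ A`, `σ` induces `A/𝔞 ≅ B/((t) + 𝔞B)`.  With `𝔞 = C_{q y}` the right side is `B/𝔟`, `𝔟` the stalk of the pushed centre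
(`comap_V_ι_vanishingIdeal_centre`) — the coefficient identification of the two exceptional charts in the e-chart computation.

* `exists_ringEquiv_quotient_of_section` — ring form (`σ : A → B`, `π : B → A′`, `π ∘ σ` bijective, `ker π = (t)`).
* **`CylState.exists_sectionIso`** — at `y ∈ V` on the carrier: a local equation `t` of `𝓘_Z|_V` at `y` and, for every ideal `𝔞` of
  `𝒪_{Z,q y}`, a ring isomorphism `𝒪_{Z,q y}/𝔞 ≅ 𝒪_{V,y}/((t) ⊔ 𝔞·𝒪_{V,y})` over `q^♯`; `IsRegularLocalRing` of the target when
  `𝔞` is generated by part of a regular system of parameters.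

## References
* J. Kollár, *Lectures on Resolution of Singularities* (2007), (3.111) Step 1. [Kollar2007]
* H. Matsumura, *Commutative Ring Theory* (1986), Thm. 14.2. [Matsumura1987]
-/

-- `Summit.<Summit>.<Sub>.Theorems` with `Sub = Summit` (single-conjunct summit, D-0017)
set_option linter.dupNamespace false

noncomputable section

open CategoryTheory AlgebraicGeometry TopologicalSpace IsLocalRing
open Literature.AlgebraicGeometry.Resolution
open Scheme.IdealSheafData

namespace Summit.ResolutionOfSingularities.ResolutionOfSingularities.Theorems.DepthMultiHost

universe u

/-! ## §1 Ring form -/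

section Ring

variable {A A' B : Type u} [CommRing A] [CommRing A'] [CommRing B]

/-- **The section isomorphism, ring form**: `σ : A → B`, `π : B → A′` with `π ∘ σ` bijective and `ker π = (t)`; then for every
ideal `𝔞 ⊆ A`, `σ` induces an isomorphism `A/𝔞 ≅ B/((t) ⊔ 𝔞B)`. [folklore] -/
theorem exists_ringEquiv_quotient_of_section (σ : A →+* B) (π : B →+* A') (hbij : Function.Bijective (π.comp σ)) {t : B}
    (hker : RingHom.ker π = Ideal.span {t}) (𝔞 : Ideal A) :
    ∃ e : A ⧸ 𝔞 ≃+* B ⧸ (Ideal.span {t} ⊔ 𝔞.map σ),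
      ∀ a, e (Ideal.Quotient.mk 𝔞 a) = Ideal.Quotient.mk _ (σ a) := by
  have hle : 𝔞 ≤ (Ideal.span {t} ⊔ 𝔞.map σ).comap σ := fun a ha =>
    Ideal.mem_comap.mpr (Ideal.mem_sup_right (Ideal.mem_map_of_mem σ ha))
  set f : A ⧸ 𝔞 →+* B ⧸ (Ideal.span {t} ⊔ 𝔞.map σ) := Ideal.quotientMap _ σ hle with hf
  have hf_mk : ∀ a, f (Ideal.Quotient.mk 𝔞 a) = Ideal.Quotient.mk _ (σ a) := fun a => Ideal.quotientMap_mk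
  refine ⟨RingEquiv.ofBijective f ⟨?_, ?_⟩, hf_mk⟩
  · -- injective: `σ a ∈ (t) ⊔ 𝔞B` ⇒ `π σ a ∈ π σ (𝔞)` ⇒ `a ∈ 𝔞`
    rw [RingHom.injective_iff_ker_eq_bot, RingHom.ker_eq_bot_iff_eq_zero]
    intro x hx
    obtain ⟨a, rfl⟩ := Ideal.Quotient.mk_surjective x
    rw [hf_mk, Ideal.Quotient.eq_zero_iff_mem] at hx
    rw [Ideal.Quotient.eq_zero_iff_mem]
    -- apply `π`
    have h1 : π (σ a) ∈ (Ideal.span {t} ⊔ 𝔞.map σ).map π := Ideal.mem_map_of_mem π hx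
    rw [Ideal.map_sup, Ideal.map_span, Set.image_singleton, Ideal.map_map,
      show π t = 0 from (RingHom.mem_ker).mp (hker ▸ Ideal.mem_span_singleton_self t), Ideal.span_singleton_zero,
      bot_sup_eq] at h1
    -- `π ∘ σ` is an isomorphism `θ`; `θ a ∈ θ(𝔞)` ⇒ `a ∈ 𝔞`
    let θ : A ≃+* A' := RingEquiv.ofBijective (π.comp σ) hbij
    have h2 : (π.comp σ) a ∈ 𝔞.map (θ : A →+* A') := h1
    rw [Ideal.mem_map_iff_of_surjective (θ : A →+* A') θ.surjective] at h2
    obtain ⟨a', ha', h3⟩ := h2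
    have : a' = a := θ.injective h3
    exact this ▸ ha'
  · -- surjective: `b - σ(θ⁻¹ π b) ∈ ker π = (t)`
    intro x
    obtain ⟨b, rfl⟩ := Ideal.Quotient.mk_surjective x
    obtain ⟨a, ha⟩ := hbij.2 (π b)
    refine ⟨Ideal.Quotient.mk 𝔞 a, ?_⟩
    rw [hf_mk, Ideal.Quotient.eq]
    apply Ideal.mem_sup_left
    rw [← hker, RingHom.mem_ker, map_sub, ← RingHom.comp_apply, ha, sub_self]

end Ring

/-! ## §2 At a carrier point of the cylinder region -/

namespace CylState

variable {X : Scheme.{u}} {S : MultiHostState X} (cyl : CylState S)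

/-- [OURS · L1 W5.2 · F7(β) (β-AX) M2c, E2a] **The section isomorphism at a carrier point.**  For `y ∈ V` on the carrier there is a
local equation `t` of `𝓘_Z|_V` at `y` (`(𝓘_Z|_V)_y = (t)`, `t ≠ 0`) such that for EVERY ideal `𝔞 ⊆ 𝒪_{Z,q y}` the stalk map
`q^♯` induces `𝒪_{Z,q y}/𝔞 ≅ 𝒪_{V,y}/((t) ⊔ 𝔞·𝒪_{V,y})`. [cite: Kollar2007, (3.111) Step 1] -/
theorem exists_sectionIso (y : (cyl.V : Scheme.{u})) (hy : y ∈ (cyl.j.ker.comap cyl.V.ι).support) :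
    ∃ t : (cyl.V : Scheme.{u}).presheaf.stalk y, t ≠ 0 ∧
      stalkIdeal (cyl.j.ker.comap cyl.V.ι) y = Ideal.span {t} ∧
      ∀ 𝔞 : Ideal (cyl.Z.presheaf.stalk (cyl.q y)),
        ∃ e : cyl.Z.presheaf.stalk (cyl.q y) ⧸ 𝔞 ≃+*
            (cyl.V : Scheme.{u}).presheaf.stalk y ⧸ (Ideal.span {t} ⊔ 𝔞.map (cyl.q.stalkMap y).hom),
          ∀ a, e (Ideal.Quotient.mk 𝔞 a) = Ideal.Quotient.mk _ ((cyl.q.stalkMap y).hom a) := by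
  obtain ⟨z₀, rfl⟩ := (cyl.mem_support_carrier_iff y).mp hy
  obtain ⟨t, ht0, -, hst, hker⟩ := cyl.exists_carrier_equation z₀
  -- the section: `jV^♯ ∘ q^♯` is the stalk map of `jV ≫ q = 𝟙`
  have hiso : IsIso ((cyl.jV ≫ cyl.q).stalkMap z₀) := by
    rw [cyl.retract, Scheme.Hom.stalkMap_id]; exact IsIso.id _
  have hcomp : ((cyl.jV ≫ cyl.q).stalkMap z₀).hom = (cyl.jV.stalkMap z₀).hom.comp (cyl.q.stalkMap (cyl.jV z₀)).hom := by
    rw [Scheme.Hom.stalkMap_comp]; rfl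
  have hbij : Function.Bijective ((cyl.jV.stalkMap z₀).hom.comp (cyl.q.stalkMap (cyl.jV z₀)).hom) := by
    rw [← hcomp]; exact (asIso ((cyl.jV ≫ cyl.q).stalkMap z₀)).commRingCatIsoToRingEquiv.bijective
  exact ⟨t, ht0, hst, fun 𝔞 => exists_ringEquiv_quotient_of_section _ _ hbij hker 𝔞⟩

/-- **The coefficient ring of the exceptional chart is regular**: for `𝔞` generated by part of a regular system of parameters of
`𝒪_{Z,q y}` (e.g. the stalk of an snc centre), `𝒪_{V,y}/((t) ⊔ 𝔞·𝒪_{V,y}) ≅ 𝒪_{Z,q y}/𝔞` is a regular local ring.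
[cite: Matsumura1987, Thm. 14.2] -/
theorem isRegularLocalRing_quotient_section (y : (cyl.V : Scheme.{u})) {t : (cyl.V : Scheme.{u}).presheaf.stalk y}
    {c : ℕ} {a : Fin c → cyl.Z.presheaf.stalk (cyl.q y)} (ha : IsRsopPart a)
    (e : cyl.Z.presheaf.stalk (cyl.q y) ⧸ Ideal.span (Set.range a) ≃+*
      (cyl.V : Scheme.{u}).presheaf.stalk y ⧸ (Ideal.span {t} ⊔ (Ideal.span (Set.range a)).map (cyl.q.stalkMap y).hom)) :
    IsRegularLocalRing
      ((cyl.V : Scheme.{u}).presheaf.stalk y ⧸ (Ideal.span {t} ⊔ (Ideal.span (Set.range a)).map (cyl.q.stalkMap y).hom)) :=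
  haveI := ha.isRegularLocalRing_quotient
  IsRegularLocalRing.of_ringEquiv e

end CylState

end Summit.ResolutionOfSingularities.ResolutionOfSingularities.Theorems.DepthMultiHost

end
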